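/- Copyright: the b2b-balaban cell (near-miss cell 7), T⁴-continuum fan-out; row NE7b CRUX team (2), seat
t4-ne7b-formalise-leaf-02 (the row owner's INTERFACE REQUEST NE7b IR-41-5 «S12-W», leaf-02 part (E8) of `CLAIMS.log`
l.27398 — THE W-HEADLINE: the headline of record p224237 re-plugged over the memory-agnostic carrier).  Released under the
licence of the surrounding project. -/
import Summits.QuantumFields.BalabanUV.T4Continuum.Support.HistoryRealiseCellsRunPinnedT3bPW
import Summits.QuantumFields.BalabanUV.T4Continuum.Support.HistoryRealiseCellsRunApexT3bW
import Summits.QuantumFields.BalabanUV.T4Continuum.Support.HistoryRealiseCellsRunHeadlineT3bP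

/-!
# Realised histories: THE HEADLINE FROM THE COUNT ROAD OVER THE REPAIRED END v3.1, MEMORY-AGNOSTIC CARRIER (W-HEADLINE)
(INTERFACE REQUEST NE7b IR-41-5 «S12-W», leaf-02 part, file E8 = the terminal statement of the S12-W work list; repair
route R-41-a of R-OWNER-41-1)

Summits-side support leaf of the T⁴-continuum cell (rung (B)+1 on a FINITE torus only; NOT infinite volume, NOT the
mass gap, NOT the Clay statement; NOT a proof of the spine estimate NE7b, which is the cell's OWN estimate, NOT PRINTED
and NOT PROVED).  Row NE7b, route «COUNT» ∕ R-P1, row S12-W (owner's IR-41-5, `HOME/INBOX.md` l.651: «terminal statement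
IDENTICAL to the headline of record p224237's with the W-carrier in the hypothesis»; leaf-02's fixed names `CLAIMS.log`
l.27398): E8 = the W-twin of this seat's `HistoryRealiseCellsRunHeadlineT3bP` (p224237, THE HEADLINE OF RECORD).

WHY ∕ WHAT.  Repair route R-41-a (the END must not depend on the readiness CONVENTION; located MODEL findings
F-ne7bp1g40-1 and #3 — B16 = [Balaban1989LargeFieldII] pp. 383–384, B15 = [Balaban1989LargeFieldI] pp. 177, 198,
manuscripts UNDER AUDIT, locators only): the six theorems of the headline of record RE-PLUGGED over the memory-agnostic
witness `CountRoadWitnessT3bW` (file E6: `realised : RealisedDomainsRW …`, i.e. H3 asks at renewals only condition (i) at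
the readiness index + frozen pendency before it, and STRICT pendency at joins and at the cutoff — the reading EVERY
readiness convention with memory `≤ R t₀` satisfies) and the W-pinned repaired END
`HistoryRealiseCellsRunPinnedT3bPW.hybridNE7_of_realisedDomainsRunW_pinnedT3bPD` (file E5):
**`hybridNE7Under_of_countRoadT3bPW_fsc`**, `hybridNE7Under_of_countRoadT3bPW`, `limit_exists_of_countRoadT3bPW_fsc`,
`limit_unique_of_countRoadT3bPW_fsc`, `targets_of_countRoadT3bPW_fsc`, **`continuumYM4Torus_of_countRoadT3bPW_fsc`** —
statements = p224237's with `CountRoadWitnessT3b ↦ CountRoadWitnessT3bW` (the ONLY change in the hypothesis), proofs =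
p224237's with `…pinnedT3bPD ↦ …RunW_pinnedT3bPD`, `stringHybridNE7_of_hybridNE7T3b ↦ …T3bW`; conclusions
(`HybridNE7Under D (BetaPertHyp D.βfun)`, `D.ym4_torus_continuum_limit_exists ∕ _unique`, the four targets,
`T4ContinuumYM4Torus.ContinuumYM4Torus D`) BYTE-IDENTICAL.  The carrier-free `exists_consts_countRoadT3bP` (the
constants-side antecedent is inhabited) is NOT restated — BY NAME from p224237, imported.  Since `CountRoadWitnessT3b.toW`
(E6) maps every landed witness to a W-witness, this W-headline IMPLIES the headline of record — KERNEL-CHECKED here as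
the closing `example` (p224237's own hypothesis ⇒ its conclusion through the W-chain, `ForSmallCouplings.mono`; an
`example` and not a named theorem because its statement IS, binder for binder, p224237's
`continuumYM4Torus_of_countRoadT3bP_fsc` — a named copy would restate a landed declaration).  [folklore] composition by
name; no `def`, no `[cite:]` tag, nothing printed asserted, no `Prop` fact minted (c1), zero `sorry`.  Append-only:
p224237 stays, UNCHANGED BY NAME.

HONEST READING (unchanged but for the carrier): `ContinuumYM4Torus D` for (0.4)-block-averaged `SU(N)` data ⇐
(B) = `B16.EndStatementBPrinted D.C` ∧ `BetaPertHyp D.βfun` (BY NAME) ∧ the datum's sign conventions ∧ the repaired END's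
INHABITED constants-only side conditions ∧ [∀ small-coupling tuned run ∀ loop string, a `CountRoadWitnessT3bW`]; the
witness DISPLAYS H3^NE7b in its W-form (the owner's R-41-a carrier — same class R, now free of the readiness convention),
the E1∕E2 representation identities, the (B)-side data, NE7c's `ShellWeightBound`, NE7's `ReindexedBudget`, four summable
rates — hypothesis shapes, none in print, none a theorem of the tree; NOTHING of them is discharged here; by-name class
of every `WALL-NE7b-P1.md` §2 binder UNCHANGED; located open point G-M4-1 (touch-connected births) untouched; NE7b NOT
proved; spine count 0∕9.  HONEST DEPENDENCY (cell): continuum YM on T⁴ ⇐ BetaPertH ∧ nine spine estimates (0/9 proved);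
BetaPertH ⇐ (D1) ∧ (D4) ∧ CAP+tail; G-an2-4 gates asym, D1 and NE2/3/4.  This file changes none of it. -/

open Literature.MathematicalPhysics.QuantumFieldTheory.Balaban1983to89
open T4Continuum T4PrintedShapeBanking T4CanonicalMenus
open Summit.QuantumFields.BalabanUV.T4Continuum.CountThresholdUniform
open Summit.QuantumFields.BalabanUV.T4Continuum.HistoryConstants
open Summit.QuantumFields.BalabanUV.T4Continuum.HistoryZoneEvolve (cth)
open Summit.QuantumFields.BalabanUV.T4Continuum.HistoryRealiseCellsRunPinnedT3bP
open Summit.QuantumFields.BalabanUV.T4Continuum.HistoryRealiseCellsRunApexT3b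

open Summit.QuantumFields.BalabanUV.T4Continuum.HistoryRealisePrint Summit.QuantumFields.BalabanUV.T4Continuum.HistoryRealiseWeak
open Summit.QuantumFields.BalabanUV.T4Continuum.HistoryRealisePrintReading Summit.QuantumFields.BalabanUV.T4Continuum.HistoryRealiseWeakReading
open Summit.QuantumFields.BalabanUV.T4Continuum.HistoryRealisePrintCells Summit.QuantumFields.BalabanUV.T4Continuum.HistoryRealiseWeakCells
open Summit.QuantumFields.BalabanUV.T4Continuum.HistoryRealiseCellsRunMultEndPDW Summit.QuantumFields.BalabanUV.T4Continuum.HistoryRealiseCellsRunPinnedT3bPW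
open Summit.QuantumFields.BalabanUV.T4Continuum.HistoryRealiseCellsRunApexT3bW Summit.QuantumFields.BalabanUV.T4Continuum.HistoryRealiseCellsRunHeadlineT3bP
namespace Summit.QuantumFields.BalabanUV.T4Continuum.HistoryRealiseCellsRunHeadlineT3bPW

noncomputable section

section Under

variable {F : T4Family} {G : Type*} [GaugeGroup G] [MeasurableSpace G] [HaarData G] [RegularGaugeGroup G]

/-- **ROW NE7b AT THE APEX OVER THE REPAIRED END v3.1: `HybridNE7Under D (BetaPertHyp D.βfun)` FROM THE PREFIXED WITNESS
HYPOTHESIS, NO DEMAND ON PRINT's CONSTANTS.**  For data with measurable averaging maps, the datum's sign conventions and the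
repaired END's constants-only side conditions (any positive slack `θ`; inhabited — `exists_consts_countRoadT3bP`): if
`ForSmallCouplings D (g₀ ↦ ∀ os, a CountRoadWitnessT3bW)` (H3 + representation + (B)-side data + NE7c + NE7 + rates —
DISPLAYED, none in print, none a theorem of the tree), then the apex input holds; thresholds `min γ₁ γ₂`, `min g₁ g₂` of the
pinned END v3.1 (`hybridNE7_of_realisedDomainsRunW_pinnedT3bPD` — consuming `(B)`, `BetaPertHyp` BY NAME and paying the
multiplicity's level inside its `g₁`) and of the hypothesis.  Honest reading: the four T⁴ targets ⇐ (B) ∧ BetaPertHyp ∧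
[∀ small-coupling tuned run ∀ string, a count-road witness].  NE7b NOT proved. [folklore] -/
theorem hybridNE7Under_of_countRoadT3bPW_fsc (D : FiniteEpsData F G) (hM : D.AvgMeasurable)
    (hsign : B16.SignConventions D.C)
    {C : T4PrintedShapeBanking.Consts} {O : PrintedO1s}
    {rr : ℕ} {β₀ : ℝ} (h : ThresholdOK C F.L rr β₀) (hμ : 0 < C.μ) (d n : ℕ)
    (hκ₁ : (d : ℝ) * Real.log F.L + 2 * Real.log 2 ≤ C.κ₁) (hE₀ : Real.log (2 + birthMass C) ≤ C.E₀)
    (hA₀ : 1 ≤ C.A₀) (hβ₀ : 0 < β₀) (hLβ : (F.L : ℝ) * β₀ ≤ 1) (hn₁ : 13 ≤ C.n₁) (hn : 0 < n)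
    {θ : ℝ} (hθ : 0 < θ) (hslack : C.a + θ ≤ O.γ₀ * O.A₁ ^ 2 / 2)
    (hE₂ : 0 < C.E₂) (hE₃ : 0 ≤ C.E₃) {sS : ℕ} (hsS : 1 ≤ sS)
    (hsmall : (((2 * cth 32 1 sS + 1) ^ d : ℕ) : ℝ) * (5 : ℝ) ^ d * ((max 1 (2 * 32 + 2) : ℕ) : ℝ) ≤
      (F.L : ℝ) ^ (sS / 2) / 2)
    {θc : ℝ} (hθc0 : 0 ≤ θc) (hθc1 : θc < 1) (hθcs : 1 / 2 ≤ θc ^ sS)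
    (hData : T4ContinuumYM4Torus.ForSmallCouplings D fun g₀ => ∀ os : List (ULoop F),
        ∃ (ι α π : Type) (_ : DecidableEq ι) (_ : DecidableEq α) (_ : DecidableEq π),
          Nonempty (CountRoadWitnessT3bW D C O rr d n hn g₀ os ι α π)) :
    T4ApexHybrid.HybridNE7Under D (BetaPertHyp D.βfun) := by
  intro hB hβ
  obtain ⟨γ₁, hγ₁, H⟩ := hybridNE7_of_realisedDomainsRunW_pinnedT3bPD D hB hβ hsign h hμ d n hκ₁ hE₀ hA₀ hβ₀ hLβ hn₁ hn
    hθ hslack hE₂ hE₃ hsS hsmall hθc0 hθc1 hθcs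
  obtain ⟨γ₂, hγ₂, H₂⟩ := hData
  refine ⟨min γ₁ γ₂, lt_min hγ₁ hγ₂, fun γ hγ hγle => ?_⟩
  obtain ⟨g₁, hg₁, Hg⟩ := H γ hγ (hγle.trans (min_le_left _ _))
  obtain ⟨g₂, hg₂, Hg₂⟩ := H₂ γ hγ (hγle.trans (min_le_right _ _))
  refine ⟨min g₁ g₂, lt_min hg₁ hg₂, fun g hg hgle g₀ ht os => ?_⟩
  obtain ⟨Em, -, HE⟩ := Hg g hg (hgle.trans (min_le_left _ _))
  obtain ⟨ι, α, π, _, _, _, ⟨X⟩⟩ := Hg₂ g hg (hgle.trans (min_le_right _ _)) g₀ ht os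
  have hm : ∀ K o, Measurable ((D.scheme g₀).obs K o) := fun K o => D.measurable_avgObs hM K o
  have h1 : ∀ K o U, |(D.scheme g₀).obs K o U| ≤ 1 := fun K o U => D.abs_avgObs_le_one K o U
  obtain ⟨K₁, K₂, hK₁, hH⟩ := HE g₀ ht X.l₀ X.vol X.K₀ X.T X.A X.A' X.shA X.shB X.dead X.dead' X.nup X.mup X.Nup
    X.Cc X.Rr X.CcRec X.RrRec X.ν X.u X.s₂ X.q₀ X.r X.s X.Wsh (fun K => T4GenFunBounds.prodObs (D.scheme g₀) K os) 1
    (fun K => T4GenFunBounds.measurable_prodObs (D.scheme g₀) hm K os)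
    (fun K U => T4GenFunBounds.abs_prodObs_le_one (D.scheme g₀) h1 K os U)
    (fun K t ht hK => (X.reprA K t ht hK).le) (fun K t ht hK => (X.reprB K t ht hK).le) X.c₀ X.n₁ X.c₀_pos X.floor
    X.floor' X.sites X.sites' X.Nup_nonneg X.nup_bd X.mup_bd X.R X.isRj X.one_le_R X.ped X.cellP X.liveC X.Zd X.realised
    X.step_le X.disjointJoins X.boxedBirths X.κ X.κ' X.cost_le X.cost_le' X.FcM X.RfM X.FcM' X.RfM' X.priceM X.priceM'
    X.upM X.deadM_nonneg X.resumM X.FM_nonneg X.upM' X.deadM'_nonneg X.resumM' X.FM'_nonneg X.shell X.budget X.sum_r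
    X.sum_u X.sum_s X.sum_s₂
  exact ⟨X.l₀, X.vol, K₁ + K₂, X.l₀_pos, X.vol_pos, stringHybridNE7_of_hybridNE7T3bW D X hK₁ hH⟩

/-- **The every-`γ, g > 0` form** (a witness for EVERY positive-coupling tuned run and every string; thresholds `1, 1` on
the hypothesis' side): corollary of `hybridNE7Under_of_countRoadT3bPW_fsc`.  CONDITIONAL; NE7b NOT proved. [folklore] -/
theorem hybridNE7Under_of_countRoadT3bPW (D : FiniteEpsData F G) (hM : D.AvgMeasurable)
    (hsign : B16.SignConventions D.C)
    {C : T4PrintedShapeBanking.Consts} {O : PrintedO1s}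
    {rr : ℕ} {β₀ : ℝ} (h : ThresholdOK C F.L rr β₀) (hμ : 0 < C.μ) (d n : ℕ)
    (hκ₁ : (d : ℝ) * Real.log F.L + 2 * Real.log 2 ≤ C.κ₁) (hE₀ : Real.log (2 + birthMass C) ≤ C.E₀)
    (hA₀ : 1 ≤ C.A₀) (hβ₀ : 0 < β₀) (hLβ : (F.L : ℝ) * β₀ ≤ 1) (hn₁ : 13 ≤ C.n₁) (hn : 0 < n)
    {θ : ℝ} (hθ : 0 < θ) (hslack : C.a + θ ≤ O.γ₀ * O.A₁ ^ 2 / 2)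
    (hE₂ : 0 < C.E₂) (hE₃ : 0 ≤ C.E₃) {sS : ℕ} (hsS : 1 ≤ sS)
    (hsmall : (((2 * cth 32 1 sS + 1) ^ d : ℕ) : ℝ) * (5 : ℝ) ^ d * ((max 1 (2 * 32 + 2) : ℕ) : ℝ) ≤
      (F.L : ℝ) ^ (sS / 2) / 2)
    {θc : ℝ} (hθc0 : 0 ≤ θc) (hθc1 : θc < 1) (hθcs : 1 / 2 ≤ θc ^ sS)
    (hData : ∀ (γ g : ℝ) (g₀ : ℕ → ℝ), 0 < γ → 0 < g → D.Tuned γ g g₀ →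
      ∀ os : List (ULoop F), ∃ (ι α π : Type) (_ : DecidableEq ι) (_ : DecidableEq α) (_ : DecidableEq π),
        Nonempty (CountRoadWitnessT3bW D C O rr d n hn g₀ os ι α π)) :
    T4ApexHybrid.HybridNE7Under D (BetaPertHyp D.βfun) :=
  hybridNE7Under_of_countRoadT3bPW_fsc D hM hsign h hμ d n hκ₁ hE₀ hA₀ hβ₀ hLβ hn₁ hn hθ hslack hE₂ hE₃ hsS hsmall hθc0 hθc1 hθcs
    ⟨1, one_pos, fun γ hγ _ => ⟨1, one_pos, fun g hg _ g₀ ht => hData γ g g₀ hγ hg ht⟩⟩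

/-- **COROLLARY: EXISTENCE** of the continuum limit of every joint expectation of unit-scale averaged loop variables along
the full sequence of spacings, under the prefix (`D.ym4_torus_continuum_limit_exists`), GIVEN the prefixed witnesses — by
`T4ApexHybrid.limit_exists_of_hybridNE7Under` over the repaired END v3.1.  CONDITIONAL; NE7b NOT proved. [folklore] -/
theorem limit_exists_of_countRoadT3bPW_fsc (D : FiniteEpsData F G) (hM : D.AvgMeasurable)
    (hsign : B16.SignConventions D.C)
    {C : T4PrintedShapeBanking.Consts} {O : PrintedO1s}
    {rr : ℕ} {β₀ : ℝ} (h : ThresholdOK C F.L rr β₀) (hμ : 0 < C.μ) (d n : ℕ)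
    (hκ₁ : (d : ℝ) * Real.log F.L + 2 * Real.log 2 ≤ C.κ₁) (hE₀ : Real.log (2 + birthMass C) ≤ C.E₀)
    (hA₀ : 1 ≤ C.A₀) (hβ₀ : 0 < β₀) (hLβ : (F.L : ℝ) * β₀ ≤ 1) (hn₁ : 13 ≤ C.n₁) (hn : 0 < n)
    {θ : ℝ} (hθ : 0 < θ) (hslack : C.a + θ ≤ O.γ₀ * O.A₁ ^ 2 / 2)
    (hE₂ : 0 < C.E₂) (hE₃ : 0 ≤ C.E₃) {sS : ℕ} (hsS : 1 ≤ sS)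
    (hsmall : (((2 * cth 32 1 sS + 1) ^ d : ℕ) : ℝ) * (5 : ℝ) ^ d * ((max 1 (2 * 32 + 2) : ℕ) : ℝ) ≤
      (F.L : ℝ) ^ (sS / 2) / 2)
    {θc : ℝ} (hθc0 : 0 ≤ θc) (hθc1 : θc < 1) (hθcs : 1 / 2 ≤ θc ^ sS)
    (hData : T4ContinuumYM4Torus.ForSmallCouplings D fun g₀ => ∀ os : List (ULoop F),
        ∃ (ι α π : Type) (_ : DecidableEq ι) (_ : DecidableEq α) (_ : DecidableEq π),
          Nonempty (CountRoadWitnessT3bW D C O rr d n hn g₀ os ι α π)) :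
    D.ym4_torus_continuum_limit_exists :=
  T4ApexHybrid.limit_exists_of_hybridNE7Under D hM
    (hybridNE7Under_of_countRoadT3bPW_fsc D hM hsign h hμ d n hκ₁ hE₀ hA₀ hβ₀ hLβ hn₁ hn hθ hslack hE₂ hE₃ hsS hsmall hθc0 hθc1 hθcs hData)

/-- **COROLLARY: UNIQUENESS** of the limit points (`D.ym4_torus_continuum_limit_unique`) under the same displayed data — by
`T4ApexHybrid.limit_unique_of_hybridNE7Under`.  CONDITIONAL; NE7b NOT proved. [folklore] -/
theorem limit_unique_of_countRoadT3bPW_fsc (D : FiniteEpsData F G) (hM : D.AvgMeasurable)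
    (hsign : B16.SignConventions D.C)
    {C : T4PrintedShapeBanking.Consts} {O : PrintedO1s}
    {rr : ℕ} {β₀ : ℝ} (h : ThresholdOK C F.L rr β₀) (hμ : 0 < C.μ) (d n : ℕ)
    (hκ₁ : (d : ℝ) * Real.log F.L + 2 * Real.log 2 ≤ C.κ₁) (hE₀ : Real.log (2 + birthMass C) ≤ C.E₀)
    (hA₀ : 1 ≤ C.A₀) (hβ₀ : 0 < β₀) (hLβ : (F.L : ℝ) * β₀ ≤ 1) (hn₁ : 13 ≤ C.n₁) (hn : 0 < n)
    {θ : ℝ} (hθ : 0 < θ) (hslack : C.a + θ ≤ O.γ₀ * O.A₁ ^ 2 / 2)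
    (hE₂ : 0 < C.E₂) (hE₃ : 0 ≤ C.E₃) {sS : ℕ} (hsS : 1 ≤ sS)
    (hsmall : (((2 * cth 32 1 sS + 1) ^ d : ℕ) : ℝ) * (5 : ℝ) ^ d * ((max 1 (2 * 32 + 2) : ℕ) : ℝ) ≤
      (F.L : ℝ) ^ (sS / 2) / 2)
    {θc : ℝ} (hθc0 : 0 ≤ θc) (hθc1 : θc < 1) (hθcs : 1 / 2 ≤ θc ^ sS)
    (hData : T4ContinuumYM4Torus.ForSmallCouplings D fun g₀ => ∀ os : List (ULoop F),
        ∃ (ι α π : Type) (_ : DecidableEq ι) (_ : DecidableEq α) (_ : DecidableEq π),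
          Nonempty (CountRoadWitnessT3bW D C O rr d n hn g₀ os ι α π)) :
    D.ym4_torus_continuum_limit_unique :=
  T4ApexHybrid.limit_unique_of_hybridNE7Under D hM
    (hybridNE7Under_of_countRoadT3bPW_fsc D hM hsign h hμ d n hκ₁ hE₀ hA₀ hβ₀ hLβ hn₁ hn hθ hslack hE₂ hE₃ hsS hsmall hθc0 hθc1 hθcs hData)

end Under

section SU

variable {F : T4Family} {N : ℕ} [NeZero N] {ℰ : LoopAverage (Matrix.specialUnitaryGroup (Fin N) ℂ)}

/-- **THE FOUR T⁴ TARGETS FROM THE COUNT ROAD OVER THE REPAIRED END v3.1**, for (0.4)-block-averaged data on `SU(N)` with a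
measurable small-loop average: `hybridNE7Under_of_countRoadT3bPW_fsc` ∘ `T4ApexHybrid.targets_of_hybridNE7Under`.  CONDITIONAL
on (B), `BetaPertHyp` (inside the targets' own prefix) and the displayed prefixed witnesses; NE7b NOT proved. [folklore] -/
theorem targets_of_countRoadT3bPW_fsc (D : FiniteEpsData F (Matrix.specialUnitaryGroup (Fin N) ℂ))
    (hBA : D.IsBlockAveraged ℰ) (hE : ℰ.MeasurableE) (hsign : B16.SignConventions D.C)
    {C : T4PrintedShapeBanking.Consts} {O : PrintedO1s}
    {rr : ℕ} {β₀ : ℝ} (h : ThresholdOK C F.L rr β₀) (hμ : 0 < C.μ) (d n : ℕ)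
    (hκ₁ : (d : ℝ) * Real.log F.L + 2 * Real.log 2 ≤ C.κ₁) (hE₀ : Real.log (2 + birthMass C) ≤ C.E₀)
    (hA₀ : 1 ≤ C.A₀) (hβ₀ : 0 < β₀) (hLβ : (F.L : ℝ) * β₀ ≤ 1) (hn₁ : 13 ≤ C.n₁) (hn : 0 < n)
    {θ : ℝ} (hθ : 0 < θ) (hslack : C.a + θ ≤ O.γ₀ * O.A₁ ^ 2 / 2)
    (hE₂ : 0 < C.E₂) (hE₃ : 0 ≤ C.E₃) {sS : ℕ} (hsS : 1 ≤ sS)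
    (hsmall : (((2 * cth 32 1 sS + 1) ^ d : ℕ) : ℝ) * (5 : ℝ) ^ d * ((max 1 (2 * 32 + 2) : ℕ) : ℝ) ≤
      (F.L : ℝ) ^ (sS / 2) / 2)
    {θc : ℝ} (hθc0 : 0 ≤ θc) (hθc1 : θc < 1) (hθcs : 1 / 2 ≤ θc ^ sS)
    (hData : T4ContinuumYM4Torus.ForSmallCouplings D fun g₀ => ∀ os : List (ULoop F),
        ∃ (ι α π : Type) (_ : DecidableEq ι) (_ : DecidableEq α) (_ : DecidableEq π),
          Nonempty (CountRoadWitnessT3bW D C O rr d n hn g₀ os ι α π)) :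
    D.ym4_torus_continuum_limit_exists ∧ D.ym4_torus_continuum_limit_unique ∧
      D.limit_reflectionPositive ∧ D.limit_torusCovariant :=
  T4ApexHybrid.targets_of_hybridNE7Under hBA hE
    (hybridNE7Under_of_countRoadT3bPW_fsc D (hBA.avgMeasurable hE) hsign h hμ d n hκ₁ hE₀ hA₀ hβ₀ hLβ hn₁ hn hθ hslack hE₂ hE₃ hsS hsmall hθc0 hθc1 hθcs hData)

/-- **THE HEADLINE PREDICATE FROM THE COUNT ROAD OVER THE REPAIRED END v3.1**: `T4ContinuumYM4Torus.ContinuumYM4Torus D` for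
(0.4)-block-averaged data on `SU(N)` with a measurable small-loop average, GIVEN the two pins
`(B) = B16.EndStatementBPrinted D.C` and `BetaPertHyp D.βfun` BY NAME, the datum's sign conventions, the repaired END's
INHABITED constants-only side conditions (any positive slack; `exists_consts_countRoadT3bP`), and a `CountRoadWitnessT3bW` for
all small-coupling tuned runs and every loop string (`targets_of_countRoadT3bPW_fsc` ∘
`T4ContinuumYM4Torus.continuumYM4Torus_of_targets`).  Honest reading in the module docstring: the located new estimates are
INSIDE the witness; nothing of them is discharged; the multiplicity is a theorem and its price sits in the coupling
threshold; NE7b NOT proved; count 0∕9. [folklore] -/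
theorem continuumYM4Torus_of_countRoadT3bPW_fsc (D : FiniteEpsData F (Matrix.specialUnitaryGroup (Fin N) ℂ))
    (hBA : D.IsBlockAveraged ℰ) (hE : ℰ.MeasurableE)
    (hB : B16.EndStatementBPrinted D.C) (hβ : BetaPertHyp D.βfun) (hsign : B16.SignConventions D.C)
    {C : T4PrintedShapeBanking.Consts} {O : PrintedO1s}
    {rr : ℕ} {β₀ : ℝ} (h : ThresholdOK C F.L rr β₀) (hμ : 0 < C.μ) (d n : ℕ)
    (hκ₁ : (d : ℝ) * Real.log F.L + 2 * Real.log 2 ≤ C.κ₁) (hE₀ : Real.log (2 + birthMass C) ≤ C.E₀)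
    (hA₀ : 1 ≤ C.A₀) (hβ₀ : 0 < β₀) (hLβ : (F.L : ℝ) * β₀ ≤ 1) (hn₁ : 13 ≤ C.n₁) (hn : 0 < n)
    {θ : ℝ} (hθ : 0 < θ) (hslack : C.a + θ ≤ O.γ₀ * O.A₁ ^ 2 / 2)
    (hE₂ : 0 < C.E₂) (hE₃ : 0 ≤ C.E₃) {sS : ℕ} (hsS : 1 ≤ sS)
    (hsmall : (((2 * cth 32 1 sS + 1) ^ d : ℕ) : ℝ) * (5 : ℝ) ^ d * ((max 1 (2 * 32 + 2) : ℕ) : ℝ) ≤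
      (F.L : ℝ) ^ (sS / 2) / 2)
    {θc : ℝ} (hθc0 : 0 ≤ θc) (hθc1 : θc < 1) (hθcs : 1 / 2 ≤ θc ^ sS)
    (hData : T4ContinuumYM4Torus.ForSmallCouplings D fun g₀ => ∀ os : List (ULoop F),
        ∃ (ι α π : Type) (_ : DecidableEq ι) (_ : DecidableEq α) (_ : DecidableEq π),
          Nonempty (CountRoadWitnessT3bW D C O rr d n hn g₀ os ι α π)) :
    T4ContinuumYM4Torus.ContinuumYM4Torus D :=
  T4ContinuumYM4Torus.continuumYM4Torus_of_targets hB hβ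
    (targets_of_countRoadT3bPW_fsc D hBA hE hsign h hμ d n hκ₁ hE₀ hA₀ hβ₀ hLβ hn₁ hn hθ hslack hE₂ hE₃ hsS hsmall hθc0 hθc1 hθcs hData)

/-! ## The W-headline implies the headline of record, on the landed witnesses -/

/- **THE W-HEADLINE IS AT LEAST AS STRONG AS THE HEADLINE OF RECORD (round trip, by name; kernel-checked `example`).**
From p224237's OWN prefixed hypothesis — a landed-carrier `CountRoadWitnessT3b` for every small-coupling tuned run and loop
string — the W-chain gives p224237's conclusion `ContinuumYM4Torus D`: map each witness through `CountRoadWitnessT3b.toW`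
(file E6; `ForSmallCouplings.mono`) and apply `continuumYM4Torus_of_countRoadT3bPW_fsc`.  Binders and conclusion are
LITERALLY those of `HistoryRealiseCellsRunHeadlineT3bP.continuumYM4Torus_of_countRoadT3bP_fsc` (hence an `example`, not a
second declaration of that statement); nothing of print asserted; NE7b NOT proved. [folklore] -/
example (D : FiniteEpsData F (Matrix.specialUnitaryGroup (Fin N) ℂ))
    (hBA : D.IsBlockAveraged ℰ) (hE : ℰ.MeasurableE)
    (hB : B16.EndStatementBPrinted D.C) (hβ : BetaPertHyp D.βfun) (hsign : B16.SignConventions D.C)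
    {C : T4PrintedShapeBanking.Consts} {O : PrintedO1s}
    {rr : ℕ} {β₀ : ℝ} (h : ThresholdOK C F.L rr β₀) (hμ : 0 < C.μ) (d n : ℕ)
    (hκ₁ : (d : ℝ) * Real.log F.L + 2 * Real.log 2 ≤ C.κ₁) (hE₀ : Real.log (2 + birthMass C) ≤ C.E₀)
    (hA₀ : 1 ≤ C.A₀) (hβ₀ : 0 < β₀) (hLβ : (F.L : ℝ) * β₀ ≤ 1) (hn₁ : 13 ≤ C.n₁) (hn : 0 < n)
    {θ : ℝ} (hθ : 0 < θ) (hslack : C.a + θ ≤ O.γ₀ * O.A₁ ^ 2 / 2)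
    (hE₂ : 0 < C.E₂) (hE₃ : 0 ≤ C.E₃) {sS : ℕ} (hsS : 1 ≤ sS)
    (hsmall : (((2 * cth 32 1 sS + 1) ^ d : ℕ) : ℝ) * (5 : ℝ) ^ d * ((max 1 (2 * 32 + 2) : ℕ) : ℝ) ≤
      (F.L : ℝ) ^ (sS / 2) / 2)
    {θc : ℝ} (hθc0 : 0 ≤ θc) (hθc1 : θc < 1) (hθcs : 1 / 2 ≤ θc ^ sS)
    (hData : T4ContinuumYM4Torus.ForSmallCouplings D fun g₀ => ∀ os : List (ULoop F),
        ∃ (ι α π : Type) (_ : DecidableEq ι) (_ : DecidableEq α) (_ : DecidableEq π),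
          Nonempty (CountRoadWitnessT3b D C O rr d n hn g₀ os ι α π)) :
    T4ContinuumYM4Torus.ContinuumYM4Torus D :=
  continuumYM4Torus_of_countRoadT3bPW_fsc D hBA hE hB hβ hsign h hμ d n hκ₁ hE₀ hA₀ hβ₀ hLβ hn₁ hn hθ hslack hE₂ hE₃ hsS
    hsmall hθc0 hθc1 hθcs
    (hData.mono fun g₀ hg os => by
      obtain ⟨ι, α, π, i₁, i₂, i₃, ⟨X⟩⟩ := hg os
      exact ⟨ι, α, π, i₁, i₂, i₃, ⟨CountRoadWitnessT3b.toW X⟩⟩)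

end SU

end

end Summit.QuantumFields.BalabanUV.T4Continuum.HistoryRealiseCellsRunHeadlineT3bPW
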